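import Mathlib.MeasureTheory.Measure.Hausdorff
import Mathlib.MeasureTheory.Measure.Lebesgue.EqHaar
import Mathlib.Topology.MetricSpace.CoveringNumbers
import Mathlib.Analysis.Calculus.FDeriv.Basic
import Mathlib.Analysis.Normed.Module.FiniteDimension
import Mathlib.LinearAlgebra.FiniteDimensional.Lemmas
import HarnessLib

/-!
# Sard's lemma for Hausdorff measure: the image of the singular set of a Lipschitz map

Topic `Literature/Analysis/Calculus` (support file for the proof of Federer's support theorem
for integral flat chains). Everything here is proved from Mathlib; no named facts, no
definitions.

**Theorem** (`hausdorffMeasure_image_null_of_fderiv_not_injective`). Let `g : ℝ^ι → V` be a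
Lipschitz map into a real normed space `V` and let
`Z = {u : g is differentiable at u and Dg(u) is not injective}`. Then `𝓗ᵈ(g(Z)) = 0`,
`d = #ι` (`𝓗ᵈ` = Mathlib's `μH[d]` on `V`).

This is the singular part of the area formula for Lipschitz maps (Federer, *Geometric Measure
Theory*, 3.2.3 (1) with `A = {J_d g = 0}`; Evans–Gariepy, *Measure Theory and Fine Properties of
Functions*, §3.3, Lemma 3 "𝓗ⁿ(f{Jf = 0}) = 0"). Here `ℝ^ι = ι → ℝ` carries the sup norm, for
which `μH[d] = volume` (`MeasureTheory.hausdorffMeasure_pi_real`); the target measure is the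
unnormalised Hausdorff measure, and null sets are the same for every normalisation.

## The proof (a direct covering argument)

Fix `ε ∈ (0, 1]`. On `Z(ε, δ) = {u ∈ Z : ‖g y - g u - Dg(u)(y - u)‖ ≤ ε ‖y - u‖ for ‖y - u‖ ≤ δ}`
and at every scale `ρ ≤ δ`, the image of a `ρ`-cube `Q ∋ u` lies within `ε ρ` of
`g u + Dg(u)(Q - u)`, a subset of a ball of radius `L ρ` in the proper subspace `im Dg(u)`
(dimension `≤ d - 1`), which is covered by `(2L/ε + 1)^{d-1}` balls of radius `ε ρ` (volume
packing in that subspace, `exists_finset_net`). Covering `Z(ε, δ) ∩ B_R` by `(2R/ρ + 1)ᵈ` cubes of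
radius `ρ` (packing again) gives covers of `g(Z(ε, δ) ∩ B_R)` by sets of diameter `≤ 4 ε ρ` with
`Σ diamᵈ ≤ C(R, L, d) ε`, uniformly in `ρ → 0`; hence `μH[d](g(Z(ε,δ) ∩ B_R)) ≤ C ε`
(`MeasureTheory.Measure.hausdorffMeasure_le_liminf_sum`), then `δ → 0` by monotone union
(`Monotone.measure_iUnion`), `ε → 0`, `R → ∞`.

## References

* H. Federer, *Geometric Measure Theory*, Springer 1969, 3.2.3.
* L. C. Evans, R. F. Gariepy, *Measure Theory and Fine Properties of Functions*, CRC 1992, §3.3.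
-/

noncomputable section

open MeasureTheory MeasureTheory.Measure Set Function Filter Metric Module
open scoped ENNReal NNReal Topology

namespace Literature.Analysis.Calculus

/-! ### Packing and nets in finite-dimensional normed spaces -/

section Packing

variable {E : Type*} [NormedAddCommGroup E] [NormedSpace ℝ E] [FiniteDimensional ℝ E]

open scoped Function in
/-- **Packing bound by volume.** In an `n`-dimensional real normed space, finitely many points of
the ball `dist · p ≤ R` with mutual distances `≥ r > 0` number at most `(2R/r + 1)ⁿ` (the balls
of radius `r/2` about them are disjoint and lie in the ball of radius `R + r/2`; the argument of
Mathlib's `Besicovitch.card_le_of_separated` and of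
`Literature.MathematicalPhysics.StatisticalMechanics.card_le_of_separated_of_dist_le`). [folklore] -/
theorem card_le_pow_of_separated (s : Finset E) (p : E) {r R : ℝ} (hr : 0 < r) (hR : 0 ≤ R)
    (hs : ∀ c ∈ s, dist c p ≤ R) (h : ∀ c ∈ s, ∀ d ∈ s, c ≠ d → r ≤ dist c d) :
    (s.card : ℝ) ≤ (2 * R / r + 1) ^ finrank ℝ E := by
  borelize E
  let μ : Measure E := Measure.addHaar
  set δ : ℝ := r / 2 with hδ
  set ρ : ℝ := R + r / 2 with hρ
  have δpos : 0 < δ := by positivity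
  have ρpos : 0 < ρ := by positivity
  set A := ⋃ c ∈ s, ball (c : E) δ with hA
  have D : Set.Pairwise (s : Set E) (Disjoint on fun c => ball (c : E) δ) := by
    rintro c hc d hd hcd
    apply ball_disjoint_ball
    have := h c hc d hd hcd
    linarith
  have A_subset : A ⊆ ball p ρ := by
    refine iUnion₂_subset fun x hx => ?_
    apply ball_subset_ball'
    have := hs x hx
    linarith
  have I : (s.card : ℝ≥0∞) * ENNReal.ofReal (δ ^ finrank ℝ E) * μ (ball 0 1) ≤
      ENNReal.ofReal (ρ ^ finrank ℝ E) * μ (ball 0 1) :=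
    calc (s.card : ℝ≥0∞) * ENNReal.ofReal (δ ^ finrank ℝ E) * μ (ball 0 1) = μ A := by
          rw [hA, measure_biUnion_finset D fun c _ => measurableSet_ball]
          simp only [μ.addHaar_ball_of_pos _ δpos]
          simp only [Finset.sum_const, nsmul_eq_mul, mul_assoc]
      _ ≤ μ (ball p ρ) := measure_mono A_subset
      _ = ENNReal.ofReal (ρ ^ finrank ℝ E) * μ (ball 0 1) := by
          simp only [μ.addHaar_ball_of_pos _ ρpos]
  have J : (s.card : ℝ≥0∞) * ENNReal.ofReal (δ ^ finrank ℝ E) ≤ ENNReal.ofReal (ρ ^ finrank ℝ E) :=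
    (ENNReal.mul_le_mul_iff_left (measure_ball_pos _ _ zero_lt_one).ne' measure_ball_lt_top.ne).1 I
  have K : (s.card : ℝ) * δ ^ finrank ℝ E ≤ ρ ^ finrank ℝ E := by
    have := ENNReal.toReal_le_of_le_ofReal (pow_nonneg ρpos.le _) J
    simpa [ENNReal.toReal_mul, ENNReal.toReal_ofReal (pow_nonneg δpos.le _)] using this
  have hδn : 0 < δ ^ finrank ℝ E := pow_pos δpos _
  have hq : ρ / δ = 2 * R / r + 1 := by
    rw [hρ, hδ]
    field_simp
  calc (s.card : ℝ) ≤ ρ ^ finrank ℝ E / δ ^ finrank ℝ E := by rw [le_div_iff₀ hδn]; exact K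
    _ = (2 * R / r + 1) ^ finrank ℝ E := by rw [← div_pow, hq]

/-- **Nets by volume packing.** A subset `K` of the ball `dist · p ≤ R` of an `n`-dimensional real
normed space contains, for every `r > 0`, a finite `r`-net of at most `(2R/r + 1)ⁿ` points: a
maximal `r`-separated subset (Mathlib's `Metric.maximalSeparatedSet`). [folklore] -/
theorem exists_finset_net {K : Set E} {p : E} {r R : ℝ} (hr : 0 < r) (hR : 0 ≤ R)
    (hK : K ⊆ closedBall p R) :
    ∃ M : Finset E, (↑M : Set E) ⊆ K ∧ (∀ x ∈ K, ∃ m ∈ M, dist x m ≤ r) ∧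
      (M.card : ℝ) ≤ (2 * R / r + 1) ^ finrank ℝ E := by
  set rn : ℝ≥0 := ⟨r, hr.le⟩ with hrn
  have hrnpos : (0 : ℝ≥0) < rn := (NNReal.coe_pos (r := rn)).1 hr
  have hrn0 : rn ≠ 0 := hrnpos.ne'
  -- the packing number of the totally bounded set `K` is finite
  have htb : TotallyBounded K := (isCompact_closedBall p R).totallyBounded.subset hK
  have hfin : packingNumber rn K ≠ ⊤ := by
    have h2 : (rn / 2) ≠ 0 := by simpa using hrn0
    obtain ⟨N, -, hNfin, hNcov⟩ := exists_finite_isCover_of_totallyBounded h2 htb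
    have h3 := packingNumber_two_mul_le_externalCoveringNumber (rn / 2) K
    rw [mul_div_cancel₀ _ (two_ne_zero)] at h3
    exact ne_top_of_le_ne_top (ne_top_of_le_ne_top (Set.encard_ne_top_iff.2 hNfin)
      hNcov.externalCoveringNumber_le_encard) h3
  set M₀ := maximalSeparatedSet rn K with hM₀
  have hM₀K : M₀ ⊆ K := maximalSeparatedSet_subset
  have hM₀fin : M₀.Finite := by
    rw [← Set.encard_ne_top_iff, hM₀, encard_maximalSeparatedSet hfin]
    exact hfin
  have hcov := isCover_iff_subset_iUnion_closedBall.1 (isCover_maximalSeparatedSet hfin)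
  have hsep : IsSeparated (rn : ℝ≥0∞) M₀ := isSeparated_maximalSeparatedSet
  refine ⟨hM₀fin.toFinset, by simpa using hM₀K, fun x hx => ?_, ?_⟩
  · obtain ⟨m, hm, hxm⟩ := mem_iUnion₂.1 (hcov hx)
    exact ⟨m, hM₀fin.mem_toFinset.2 hm, (mem_closedBall.1 hxm : dist x m ≤ (rn : ℝ))⟩
  · refine card_le_pow_of_separated _ p hr hR (fun c hc => hK (hM₀K (hM₀fin.mem_toFinset.1 hc)))
      fun c hc d hd hcd => ?_
    have h1 : (rn : ℝ≥0∞) < edist c d :=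
      hsep (hM₀fin.mem_toFinset.1 hc) (hM₀fin.mem_toFinset.1 hd) hcd
    rw [edist_dist, ← ENNReal.ofReal_coe_nnreal] at h1
    exact (ENNReal.ofReal_lt_ofReal_iff'.1 h1).1.le

end Packing

/-! ### Nets for the image of a cube under a singular linear map -/

section LinearNet

variable {ι : Type*} [Fintype ι] {V : Type*} [NormedAddCommGroup V] [NormedSpace ℝ V]

/-- A non-injective linear map `T : ℝ^ι → V` with `‖T‖ ≤ L` maps the cube `‖y‖ ≤ ρ` into a
ball of radius `L ρ` of the proper subspace `im T`, so this image has an `ε ρ`-net of at most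
`(2L/ε + 1)^{d-1}` points, `d = #ι`. [folklore] -/
theorem exists_finset_net_image_of_not_injective (T : (ι → ℝ) →L[ℝ] V)
    (hT : ¬ Injective T) {L : ℝ} (hTL : ‖T‖ ≤ L) {ρ ε : ℝ} (hρ : 0 < ρ) (hε : 0 < ε) :
    ∃ M : Finset V, (∀ y : ι → ℝ, ‖y‖ ≤ ρ → ∃ m ∈ M, dist (T y) m ≤ ε * ρ) ∧
      (M.card : ℝ) ≤ (2 * L / ε + 1) ^ (Fintype.card ι - 1) := by
  classical
  have hL : 0 ≤ L := (norm_nonneg _).trans hTL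
  set P : Submodule ℝ V := LinearMap.range (T : (ι → ℝ) →ₗ[ℝ] V) with hP
  -- dimension count: `dim (im T) ≤ d - 1`
  have hdim : finrank ℝ P ≤ Fintype.card ι - 1 := by
    have h1 := LinearMap.finrank_range_add_finrank_ker (T : (ι → ℝ) →ₗ[ℝ] V)
    rw [finrank_fintype_fun_eq_card] at h1
    have h2 : finrank ℝ (LinearMap.ker (T : (ι → ℝ) →ₗ[ℝ] V)) ≠ 0 := by
      rw [Ne, Submodule.finrank_eq_zero, LinearMap.ker_eq_bot]
      exact hT
    rw [hP]
    omega
  -- the image of the cube inside `P`, a subset of the ball of radius `L ρ`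
  set K : Set P := {z | ∃ y : ι → ℝ, ‖y‖ ≤ ρ ∧ (z : V) = T y} with hK
  have hKball : K ⊆ closedBall (0 : P) (L * ρ) := by
    rintro z ⟨y, hy, hz⟩
    rw [mem_closedBall, dist_zero_right, ← Submodule.norm_coe, hz]
    exact (T.le_opNorm y).trans (mul_le_mul hTL hy (norm_nonneg _) hL)
  obtain ⟨M', -, hM'cov, hM'card⟩ := exists_finset_net (mul_pos hε hρ) (by positivity) hKball
  refine ⟨M'.image Subtype.val, fun y hy => ?_, ?_⟩
  · have hz : (⟨T y, LinearMap.mem_range_self _ y⟩ : P) ∈ K := ⟨y, hy, rfl⟩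
    obtain ⟨m, hm, hzm⟩ := hM'cov _ hz
    exact ⟨m, Finset.mem_image_of_mem _ hm, by simpa [Subtype.dist_eq] using hzm⟩
  · calc ((M'.image Subtype.val).card : ℝ) ≤ M'.card := by exact_mod_cast Finset.card_image_le
      _ ≤ (2 * (L * ρ) / (ε * ρ) + 1) ^ finrank ℝ P := hM'card
      _ = (2 * L / ε + 1) ^ finrank ℝ P := by
          congr 1
          field_simp
      _ ≤ (2 * L / ε + 1) ^ (Fintype.card ι - 1) :=
          pow_le_pow_right₀ (le_add_of_nonneg_left (by positivity)) hdim

end LinearNet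

/-! ### The singular set of a Lipschitz map has Hausdorff-null image -/

section Sard

variable {ι : Type*} [Fintype ι] {V : Type*} [NormedAddCommGroup V] [NormedSpace ℝ V]
  [MeasurableSpace V] [BorelSpace V]

/-- The main covering estimate. For `g : ℝ^ι → V` with `‖Dg‖ ≤ L` on the set
`A ⊆ {u : ‖g y - g u - Dg(u)(y - u)‖ ≤ ε ‖y - u‖ whenever ‖y - u‖ ≤ δ, Dg(u) not injective}`,
`A ⊆ B(0, R)`, one has `μH[d](g(A)) ≤ (4 (2R + 1))ᵈ (2L + 1)^{d-1} ε` (`0 < ε ≤ 1`, `0 < δ ≤ 1`).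
[cite: Federer1969, 3.2.3 (proof)] -/
theorem hausdorffMeasure_image_le_of_linear_approx {g : (ι → ℝ) → V} {L R ε δ : ℝ}
    (hd : 0 < Fintype.card ι) (hL : 0 ≤ L) (hR : 0 ≤ R) (hε : 0 < ε) (hε1 : ε ≤ 1)
    (hδ : 0 < δ) (hδ1 : δ ≤ 1) {A : Set (ι → ℝ)} (hAR : A ⊆ closedBall 0 R)
    (hA : ∀ u ∈ A, ∃ T : (ι → ℝ) →L[ℝ] V, ¬ Injective T ∧ ‖T‖ ≤ L ∧
      ∀ y, dist y u ≤ δ → ‖g y - g u - T (y - u)‖ ≤ ε * dist y u) :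
    μH[Fintype.card ι] (g '' A) ≤
      ENNReal.ofReal ((4 * (2 * R + 1)) ^ Fintype.card ι * (2 * L + 1) ^ (Fintype.card ι - 1) * ε) := by
  classical
  set d := Fintype.card ι with hd_def
  choose! T hTinj hTL hTapprox using hA
  -- nets for the images of cubes under the singular differentials
  have hnet : ∀ u ∈ A, ∀ ρ : ℝ, 0 < ρ → ∃ M : Finset V,
      (∀ y : ι → ℝ, ‖y‖ ≤ ρ → ∃ m ∈ M, dist (T u y) m ≤ ε * ρ) ∧
        (M.card : ℝ) ≤ (2 * L / ε + 1) ^ (d - 1) :=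
    fun u hu ρ hρ => exists_finset_net_image_of_not_injective (T u) (hTinj u hu) (hTL u hu) hρ hε
  choose! M hMcov hMcard using hnet
  -- scales `ρ n = δ / (n + 1)` and `ρ n`-nets `N n` of `A`
  set ρ : ℕ → ℝ := fun n => δ / (n + 1) with hρ_def
  have hρpos : ∀ n, 0 < ρ n := fun n => by positivity
  have hρδ : ∀ n, ρ n ≤ δ := fun n => div_le_self hδ.le (by linarith)
  have hρ1 : ∀ n, ρ n ≤ 1 := fun n => (hρδ n).trans hδ1
  have hnetA : ∀ n, ∃ N : Finset (ι → ℝ), (↑N : Set (ι → ℝ)) ⊆ A ∧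
      (∀ x ∈ A, ∃ c ∈ N, dist x c ≤ ρ n) ∧ (N.card : ℝ) ≤ (2 * R / ρ n + 1) ^ d := by
    intro n
    have := exists_finset_net (E := ι → ℝ) (hρpos n) hR hAR
    rwa [finrank_fintype_fun_eq_card] at this
  choose N hNA hNcov hNcard using hnetA
  -- the covers: closed balls of radius `2 ε ρ n` about the points `g c + m`
  let C : ℕ → Finset V := fun n => (N n).biUnion fun c => (M c (ρ n)).image fun m => g c + m
  let t : ∀ n : ℕ, ↥(C n) → Set V := fun n z => closedBall (z : V) (2 * ε * ρ n)
  have hcover : ∀ n, g '' A ⊆ ⋃ z, t n z := by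
    intro n
    rintro _ ⟨a, ha, rfl⟩
    obtain ⟨c, hc, hac⟩ := hNcov n a ha
    have hcA : c ∈ A := hNA n hc
    have h1 : ‖g a - g c - T c (a - c)‖ ≤ ε * ρ n :=
      (hTapprox c hcA a (hac.trans (hρδ n))).trans (mul_le_mul_of_nonneg_left hac hε.le)
    obtain ⟨m, hm, h2⟩ := hMcov c hcA (ρ n) (hρpos n) (a - c) (by rwa [← dist_eq_norm])
    have hz : g c + m ∈ C n := Finset.mem_biUnion.2 ⟨c, hc, Finset.mem_image_of_mem _ hm⟩
    refine mem_iUnion.2 ⟨⟨g c + m, hz⟩, ?_⟩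
    change g a ∈ closedBall (g c + m) (2 * ε * ρ n)
    rw [mem_closedBall, dist_eq_norm]
    calc ‖g a - (g c + m)‖ = ‖(g a - g c - T c (a - c)) + (T c (a - c) - m)‖ := by abel_nf
      _ ≤ ‖g a - g c - T c (a - c)‖ + ‖T c (a - c) - m‖ := norm_add_le _ _
      _ ≤ ε * ρ n + ε * ρ n := add_le_add h1 (by rwa [← dist_eq_norm])
      _ = 2 * ε * ρ n := by ring
  have hdiam : ∀ n (z : ↥(C n)), ediam (t n z) ≤ ENNReal.ofReal (4 * ε * ρ n) := by
    intro n z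
    refine ediam_le fun x hx y hy => ?_
    rw [edist_dist]
    apply ENNReal.ofReal_le_ofReal
    calc dist x y ≤ dist x z + dist y z := dist_triangle_right _ _ _
      _ ≤ 2 * ε * ρ n + 2 * ε * ρ n := add_le_add hx hy
      _ = 4 * ε * ρ n := by ring
  -- cardinality of the covers
  have hcardC : ∀ n, ((C n).card : ℝ) ≤ (2 * R / ρ n + 1) ^ d * (2 * L / ε + 1) ^ (d - 1) := by
    intro n
    calc ((C n).card : ℝ) ≤ ∑ c ∈ N n, (((M c (ρ n)).image fun m => g c + m).card : ℝ) := by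
          exact_mod_cast Finset.card_biUnion_le
      _ ≤ ∑ c ∈ N n, (2 * L / ε + 1) ^ (d - 1) := Finset.sum_le_sum fun c hc =>
          le_trans (by exact_mod_cast Finset.card_image_le) (hMcard c (hNA n hc) (ρ n) (hρpos n))
      _ = (N n).card * (2 * L / ε + 1) ^ (d - 1) := by rw [Finset.sum_const, nsmul_eq_mul]
      _ ≤ (2 * R / ρ n + 1) ^ d * (2 * L / ε + 1) ^ (d - 1) :=
          mul_le_mul_of_nonneg_right (hNcard n) (by positivity)
  -- the sums `Σ diam^d` are bounded by `C ε`, uniformly in `n`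
  set K : ℝ := (4 * (2 * R + 1)) ^ d * (2 * L + 1) ^ (d - 1) * ε with hK
  have hsum : ∀ n, ∑ z : ↥(C n), ediam (t n z) ^ (d : ℝ) ≤ ENNReal.ofReal K := by
    intro n
    have hερ : 0 ≤ 4 * ε * ρ n := by have := hρpos n; positivity
    calc ∑ z : ↥(C n), ediam (t n z) ^ (d : ℝ)
        ≤ ∑ _z : ↥(C n), ENNReal.ofReal (4 * ε * ρ n) ^ (d : ℝ) :=
          Finset.sum_le_sum fun z _ => by gcongr; exact hdiam n z
      _ = (C n).card * ENNReal.ofReal ((4 * ε * ρ n) ^ d) := by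
          rw [Finset.sum_const, nsmul_eq_mul, Finset.card_univ, Fintype.card_coe,
            ENNReal.rpow_natCast, ENNReal.ofReal_pow hερ]
      _ = ENNReal.ofReal ((C n).card * (4 * ε * ρ n) ^ d) := by
          rw [ENNReal.ofReal_mul (Nat.cast_nonneg _), ENNReal.ofReal_natCast]
      _ ≤ ENNReal.ofReal K := ENNReal.ofReal_le_ofReal ?_
    -- the real inequality
    have hρn := hρpos n
    have e1 : (2 * R / ρ n + 1) * (4 * ε * ρ n) = 4 * ε * (2 * R + ρ n) := by
      field_simp
    have e2 : ε * (2 * L / ε + 1) = 2 * L + ε := by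
      field_simp
    have e3 : ε ^ d = ε * ε ^ (d - 1) := by
      conv_lhs => rw [← Nat.sub_add_cancel hd, pow_succ']
    calc ((C n).card : ℝ) * (4 * ε * ρ n) ^ d
        ≤ (2 * R / ρ n + 1) ^ d * (2 * L / ε + 1) ^ (d - 1) * (4 * ε * ρ n) ^ d :=
          mul_le_mul_of_nonneg_right (hcardC n) (by positivity)
      _ = ((2 * R / ρ n + 1) * (4 * ε * ρ n)) ^ d * (2 * L / ε + 1) ^ (d - 1) := by
          simp only [mul_pow]
          ring
      _ = (4 * ε * (2 * R + ρ n)) ^ d * (2 * L / ε + 1) ^ (d - 1) := by rw [e1]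
      _ = (4 * (2 * R + ρ n)) ^ d * (ε * (ε ^ (d - 1) * (2 * L / ε + 1) ^ (d - 1))) := by
          simp only [mul_pow]
          rw [e3]
          ring
      _ = (4 * (2 * R + ρ n)) ^ d * (ε * (2 * L + ε) ^ (d - 1)) := by rw [← mul_pow, e2]
      _ ≤ (4 * (2 * R + 1)) ^ d * (ε * (2 * L + 1) ^ (d - 1)) := by
          gcongr
          exact hρ1 n
      _ = K := by rw [hK]; ring
  -- conclude with the Hausdorff measure bound along `ρ n → 0`
  have hρt : Tendsto ρ atTop (𝓝 0) := by
    have h := (tendsto_one_div_add_atTop_nhds_zero_nat (𝕜 := ℝ)).const_mul δ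
    rw [mul_zero] at h
    refine h.congr fun n => ?_
    simp only [hρ_def]
    ring
  have hr : Tendsto (fun n => ENNReal.ofReal (4 * ε * ρ n)) atTop (𝓝 0) := by
    have h := hρt.const_mul (4 * ε)
    rw [mul_zero] at h
    rw [← ENNReal.ofReal_zero]
    exact ENNReal.tendsto_ofReal h
  calc μH[d] (g '' A) ≤ liminf (fun n => ∑ z : ↥(C n), ediam (t n z) ^ (d : ℝ)) atTop :=
        hausdorffMeasure_le_liminf_sum (d : ℝ) (g '' A) (fun n => ENNReal.ofReal (4 * ε * ρ n)) hr t
          (Eventually.of_forall hdiam) (Eventually.of_forall hcover)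
    _ ≤ ENNReal.ofReal K := liminf_le_of_frequently_le' (Frequently.of_forall hsum)

/-- **Sard's lemma for Hausdorff measure (singular set of a Lipschitz map).** If
`g : ℝ^ι → V` is Lipschitz, the set of points at which `g` is differentiable with a non-injective
differential is mapped by `g` onto an `𝓗ᵈ`-null set, `d = #ι`: "𝓗ᵐ[f(A)] = 0 whenever
`A ⊆ {x : J_m f(x) = 0}`" (Federer 3.2.3, the case of vanishing Jacobian; Evans–Gariepy §3.3
Lemma 3). [cite: Federer1969, 3.2.3] -/
theorem hausdorffMeasure_image_null_of_fderiv_not_injective {g : (ι → ℝ) → V} {L : ℝ≥0}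
    (hg : LipschitzWith L g) :
    μH[Fintype.card ι] (g '' {u | DifferentiableAt ℝ g u ∧ ¬ Injective (fderiv ℝ g u)}) = 0 := by
  classical
  set d := Fintype.card ι with hd_def
  set Z := {u : ι → ℝ | DifferentiableAt ℝ g u ∧ ¬ Injective (fderiv ℝ g u)} with hZ
  -- the degenerate case `d = 0`: every linear map on `ℝ^∅` is injective
  rcases Nat.eq_zero_or_pos d with hd0 | hdpos
  · have : Z = ∅ := by
      refine eq_empty_iff_forall_notMem.2 fun u hu => hu.2 fun x y _ => ?_
      haveI : IsEmpty ι := Fintype.card_eq_zero_iff.1 (hd_def ▸ hd0)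
      exact Subsingleton.elim x y
    rw [this, image_empty, measure_empty]
  -- the sets `Z(ε, δ)`
  let Zε : ℝ → ℝ → Set (ι → ℝ) := fun ε δ =>
    {u | u ∈ Z ∧ ∀ y, dist y u ≤ δ → ‖g y - g u - fderiv ℝ g u (y - u)‖ ≤ ε * dist y u}
  have hZcov : ∀ ε, 0 < ε → Z ⊆ ⋃ n : ℕ, Zε ε (1 / (n + 1)) := by
    intro ε hε u hu
    have h1 := (hu.1.hasFDerivAt.isLittleO.def hε)
    obtain ⟨δ', hδ', h2⟩ := Metric.eventually_nhds_iff.1 h1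
    obtain ⟨n, hn⟩ := exists_nat_one_div_lt hδ'
    refine mem_iUnion.2 ⟨n, hu, fun y hy => ?_⟩
    rw [dist_eq_norm]
    exact h2 (hy.trans_lt hn)
  have hZmono : ∀ ε (r : ℝ), Monotone fun k : ℕ => g '' (Zε ε (1 / (k + 1)) ∩ closedBall 0 r) := by
    intro ε r m k hmk
    refine image_mono fun u hu => ⟨⟨hu.1.1, fun y hy => hu.1.2 y (hy.trans ?_)⟩, hu.2⟩
    gcongr
  -- the estimate on `Z(ε, 1/(k+1)) ∩ B(0, n)` for `ε ≤ 1`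
  have hest : ∀ ε, 0 < ε → ε ≤ 1 → ∀ n k : ℕ,
      μH[d] (g '' (Zε ε (1 / (k + 1)) ∩ closedBall 0 n)) ≤
        ENNReal.ofReal ((4 * (2 * n + 1)) ^ d * (2 * L + 1) ^ (d - 1) * ε) := by
    intro ε hε hε1 n k
    refine hausdorffMeasure_image_le_of_linear_approx hdpos L.2 n.cast_nonneg hε hε1
      (by positivity) ?_ inter_subset_right fun u hu => ⟨fderiv ℝ g u, hu.1.1.2,
        norm_fderiv_le_of_lipschitz ℝ hg, hu.1.2⟩
    rw [div_le_one (by positivity)]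
    linarith
  -- hence `μH[d] (g '' (Z ∩ B(0, n))) ≤ C ε` for all `ε`, so it vanishes
  have hball : ∀ n : ℕ, μH[d] (g '' (Z ∩ closedBall 0 n)) = 0 := by
    intro n
    set Kn : ℝ := (4 * (2 * n + 1)) ^ d * (2 * L + 1) ^ (d - 1) with hKn
    have h1 : ∀ ε, 0 < ε → ε ≤ 1 →
        μH[d] (g '' (Z ∩ closedBall 0 n)) ≤ ENNReal.ofReal (Kn * ε) := by
      intro ε hε hε1
      calc μH[d] (g '' (Z ∩ closedBall 0 n))
          ≤ μH[d] (⋃ k : ℕ, g '' (Zε ε (1 / (k + 1)) ∩ closedBall 0 n)) := by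
            refine measure_mono ?_
            rintro _ ⟨u, ⟨huZ, hun⟩, rfl⟩
            obtain ⟨k, hk⟩ := mem_iUnion.1 (hZcov ε hε huZ)
            exact mem_iUnion.2 ⟨k, u, ⟨hk, hun⟩, rfl⟩
        _ = ⨆ k : ℕ, μH[d] (g '' (Zε ε (1 / (k + 1)) ∩ closedBall 0 n)) :=
            (hZmono ε n).measure_iUnion
        _ ≤ ENNReal.ofReal (Kn * ε) := iSup_le fun k => hest ε hε hε1 n k
    -- let `ε → 0`
    refine le_antisymm ?_ bot_le
    have h2 : Tendsto (fun j : ℕ => ENNReal.ofReal (Kn * (1 / ((j : ℝ) + 1)))) atTop (𝓝 0) := by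
      rw [← ENNReal.ofReal_zero]
      refine ENNReal.tendsto_ofReal ?_
      simpa using (tendsto_one_div_add_atTop_nhds_zero_nat (𝕜 := ℝ)).const_mul Kn
    refine ge_of_tendsto' h2 fun j => h1 _ (by positivity) ?_
    rw [div_le_one (by positivity)]
    linarith
  -- finally `Z = ⋃ₙ Z ∩ B(0, n)`
  have : g '' Z ⊆ ⋃ n : ℕ, g '' (Z ∩ closedBall 0 n) := by
    rintro _ ⟨u, hu, rfl⟩
    obtain ⟨n, hn⟩ := exists_nat_ge ‖u‖
    exact mem_iUnion.2 ⟨n, u, ⟨hu, by simpa using hn⟩, rfl⟩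
  exact measure_mono_null this (measure_iUnion_null hball)

end Sard

end Literature.Analysis.Calculus
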